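import Summits.QuantumFields.BalabanUV.Beta.SecondOrderInverseShape
import Summits.QuantumFields.BalabanUV.Beta.WardLocusCubic
import Summits.QuantumFields.BalabanUV.Beta.E3CoDressedContact

/-!
# `BalabanUV.Beta.SecondOrderContactMmRead` — binder row D1, (L4) piece (W-E) EVALUATION, part 2: **THE `mm`-READ OF THE SECOND-ORDER
# CONTACT OF THE INVERSE** — `mmRead N (conjW K V V′ (diagK g) (diagK g′) (diagK h)) = conjW (mmRead N K) (mmRead N V) (mmRead N V′) (diagK ĝ) (diagK ĝ′) (diagK ĥ)`
# with the COARSE symbols `ĝ = mmSym N g` (the fine symbol's multiplier legs at the dilated points, placed on the field legs of the coarse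
# lattice), and the assembled `mm`-read of `K3OfK(♯) − K3OfK` (β sub-cell, row BETA-an2 = BINDER-OWNERS row D1 OWNER, lineage an2 gen 18)

HONEST FRAMING (cell charter, verbatim): «discharging BetaPertH makes Balaban's UV stability UNCONDITIONAL — a real
constructive-QFT result; it is NOT the continuum limit and NOT the Clay problem.»  Neutral kernel algebra ([folklore]) over the tree's
own definitions (`BalabanStepJetsSucc.mmRead`, leaf-10's `WardLocusCubic.mmSym`, an5's `conjW`); no statement of Bałaban's papers, no
`[cite:]`, no `def`, no `Prop` fact; instantiates no binder of the wall.  NOT D1, NOT `BetaPertH`, NOT continuum, NOT Clay.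

## What is here

* §1 `mmRead_comp_diagK_right` / `mmRead_diagK_comp_left`: `mmRead N (F ∘ diagK g) = mmRead N F ∘ diagK (mmSym N g)` and its twin — a
  diagonal factor on an OUTER leg passes through the `mm`-read as its coarse symbol (entrywise: `comp_diagK_right/left`); `mmRead_comp_diagK_comp`
  (both legs); `mmRead_conjW₁_diag`, `mmRead_conjW₂_diag`, **`mmRead_conjW_diag`**: every word of an5's `conjW K V V′ X X′ X₂` with DIAGONAL
  generators carries its generators on outer legs only, so the whole contact passes through the read.
* §2 `conjW_mmRead_diag_congr`: against `mm`-reads (kernels living on the field block) the contact sees only the FIELD legs of the symbols —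
  the coarse symbols may be replaced by any symbols with the same field legs (e.g. `mmSym` of the `ℋ`-dressed generator by the next level's
  FULL product-chart generator `ctGen`, whose field leg it is by an3's `E3CoDressedContact.dressedGenK_zsmul_inr`: `mmSym_dressedGen_inl`).
* §3 **`mmRead_K3OfK_sharp_split`**: with part 1 (`SecondOrderInverseShape.K3OfK_sharp_split`),
  `mmRead N (K3OfK K N S♯ M W♯ b c) = mmRead N (K3OfK K N S M W b c)
     + conjW (mmRead N K) (mmRead N (K2OfK K N S M b)) (mmRead N (K2OfK K N S M c)) (diagK (mmSym N (G b))) (diagK (mmSym N (G c))) (diagK (mmSym N h))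
     − mmRead N (K ∘ R b c ∘ K)` —
  the level-`(j+1)` field–field second-order table of the ♯-tables IS the plain one PLUS A CONTACT OF SIMILARITY SHAPE AGAINST `mmRead N K`
  (= `(wVH (j+1))⁻¹ ·` the field block of `bhKStepAt (j+1)` for the wall's `G_j`, `SpineRecursiveClosed.mmRead_stepProp_eq_inv_wVH_mul`) with
  first-order letters `mmRead N (K2OfK … b)` (= the generic third jet `e3OfK N K S̃ b` whenever `dM K N S M b = vertexOfK K N S̃ b`,
  `mmRead_K2OfK_eq_e3OfK` — leaf-10's (c1) fold `SpineRecursiveWEnd.dM_SpureRecAt_M1At` in the wall) MINUS the transported remainder.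
NOT HERE: the level step for `T2RecAt (j+1)` (weights, the border letter, the remainder's parity) — part 3.
Provenance: β sub-cell, unit beta-an2 gen 18, 2026-08-20 (v1); no existing file touched.
-/

open Finset
open scoped BigOperators
open Literature.MathematicalPhysics.QuantumFieldTheory.Balaban1983to89
open Literature.MathematicalPhysics.QuantumFieldTheory.Balaban1983to89.Beta
open ExpKernelCalculus (MKer Decays BiLoc comp)
open OneStepResolventKernel (Fib)
open OneStepKernelFamily (colH vertexOfK)
open BalabanStepJetsSucc (mmRead mmRead_inl_inl mmRead_inr_left mmRead_inr_right)
open SecondOrderResponse (dM K2OfK)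
open BalabanStepW2 (K3OfK)
open AveragingContoursRooted (ctr)
open Summit.QuantumFields.BalabanUV.Beta.TameKernelCalculus
open Summit.QuantumFields.BalabanUV.Beta.ChartConjugation (conjV conjW conjW₁ conjW₂)
open Summit.QuantumFields.BalabanUV.Beta.ChartConjugationRelative (RelInv)
open Summit.QuantumFields.BalabanUV.Beta.BorderedHessian (diagK diagK_apply comp_diagK_right comp_diagK_left ctGen bhKAt)
open Summit.QuantumFields.BalabanUV.Beta.AxialDressingRooted (axEc)
open Summit.QuantumFields.BalabanUV.Beta.SecondOrderTransport (K2OfK_eq)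
open Summit.QuantumFields.BalabanUV.Beta.SecondOrderContactForm (conjW₁_diag_apply conjW₂_diag_apply)
open Summit.QuantumFields.BalabanUV.Beta.WardLocusCubic (mmSym)
open Summit.QuantumFields.BalabanUV.Beta.SpineRooted (e3OfK e3OfK_apply)
open Summit.QuantumFields.BalabanUV.Beta.VertexReflectionContact (mmRead_add mmRead_neg)
open Summit.QuantumFields.BalabanUV.Beta.E3CoDressedContact (dressedGenK_zsmul_inr)
open Summit.QuantumFields.BalabanUV.Beta.GAN24.ThirdJetKernel (mmRead_sub)

namespace Summit.QuantumFields.BalabanUV.Beta.SecondOrderContactMmRead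

noncomputable section

variable {d : ℕ}

/-! ## §1 Diagonal factors on outer legs pass through the `mm`-read -/

section Outer

variable (N : ℕ) (g g' h : (Fin (d + 1) → ℤ) → Fib d → ℝ)

/-- [folklore] Field legs of the coarse symbol: `mmSym N g x′ (inl α) = g (N•x′) (inr α)`. -/
@[simp] theorem mmSym_inl (x' : Fin (d + 1) → ℤ) (α : Fin (d + 1)) : mmSym N g x' (Sum.inl α) = g ((N : ℤ) • x') (Sum.inr α) := rfl

/-- [folklore] Multiplier legs of the coarse symbol vanish. -/
@[simp] theorem mmSym_inr (x' : Fin (d + 1) → ℤ) (μ : Fin (d + 1)) : mmSym N g x' (Sum.inr μ) = 0 := rfl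

/-- [folklore] **A DIAGONAL FACTOR ON THE RIGHT LEG PASSES THROUGH THE READ**: `mmRead N (F ∘ diagK g) = mmRead N F ∘ diagK (mmSym N g)`. -/
theorem mmRead_comp_diagK_right (F : MKer (d + 1) (Fib d)) : mmRead N (comp F (diagK g)) = comp (mmRead N F) (diagK (mmSym N g)) := by
  funext x z a b
  rw [comp_diagK_right]
  rcases a with α | μ <;> rcases b with β | ν
  · rw [mmRead_inl_inl, mmRead_inl_inl, comp_diagK_right, mmSym_inl]
  · rw [mmRead_inr_right, mmRead_inr_right, zero_mul]
  · rw [mmRead_inr_left, mmRead_inr_left, zero_mul]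
  · rw [mmRead_inr_left, mmRead_inr_left, zero_mul]

/-- [folklore] **A DIAGONAL FACTOR ON THE LEFT LEG PASSES THROUGH THE READ**: `mmRead N (diagK g ∘ F) = diagK (mmSym N g) ∘ mmRead N F`. -/
theorem mmRead_diagK_comp_left (F : MKer (d + 1) (Fib d)) : mmRead N (comp (diagK g) F) = comp (diagK (mmSym N g)) (mmRead N F) := by
  funext x z a b
  rw [comp_diagK_left]
  rcases a with α | μ <;> rcases b with β | ν
  · rw [mmRead_inl_inl, mmRead_inl_inl, comp_diagK_left, mmSym_inl]
  · rw [mmRead_inr_right, mmRead_inr_right, mul_zero]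
  · rw [mmRead_inr_left, mmRead_inr_left, mul_zero]
  · rw [mmRead_inr_left, mmRead_inr_left, mul_zero]

/-- [folklore] Both legs: `mmRead N (diagK g ∘ F ∘ diagK g′) = diagK ĝ ∘ mmRead N F ∘ diagK ĝ′`. -/
theorem mmRead_diagK_comp_comp_diagK (F : MKer (d + 1) (Fib d)) :
    mmRead N (comp (comp (diagK g) F) (diagK g')) = comp (comp (diagK (mmSym N g)) (mmRead N F)) (diagK (mmSym N g')) := by
  rw [mmRead_comp_diagK_right, mmRead_diagK_comp_left]

/-- [folklore] The coarse symbol of a product of symbols is the product of the coarse symbols. -/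
theorem mmSym_mul : mmSym N (fun p a => g p a * g' p a) = fun x a => mmSym N g x a * mmSym N g' x a := by
  funext x a
  rcases a with α | μ
  · rfl
  · simp only [mmSym_inr, mul_zero]

/-- [folklore] A product of two diagonal factors on the left leg: `mmRead N ((diagK g ∘ diagK g′) ∘ F) = (diagK ĝ ∘ diagK ĝ′) ∘ mmRead N F`. -/
theorem mmRead_diagK_diagK_comp_left (F : MKer (d + 1) (Fib d)) :
    mmRead N (comp (comp (diagK g) (diagK g')) F) = comp (comp (diagK (mmSym N g)) (diagK (mmSym N g'))) (mmRead N F) := by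
  rw [SecondOrderContactForm.comp_diagK_diagK, SecondOrderContactForm.comp_diagK_diagK, mmRead_diagK_comp_left, mmSym_mul]

/-- [folklore] **THE FIRST-ORDER PIECE PASSES THROUGH THE READ**:
`mmRead N (conjW₁ V V′ (diagK g) (diagK g′)) = conjW₁ (mmRead N V) (mmRead N V′) (diagK ĝ) (diagK ĝ′)`. -/
theorem mmRead_conjW₁_diag (V Vp : MKer (d + 1) (Fib d)) :
    mmRead N (conjW₁ V Vp (diagK g) (diagK g')) = conjW₁ (mmRead N V) (mmRead N Vp) (diagK (mmSym N g)) (diagK (mmSym N g')) := by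
  unfold ChartConjugation.conjW₁
  rw [mmRead_add, mmRead_sub, mmRead_sub, mmRead_comp_diagK_right, mmRead_diagK_comp_left, mmRead_comp_diagK_right, mmRead_diagK_comp_left]

/-- [folklore] **THE QUADRATIC PIECE PASSES THROUGH THE READ**:
`mmRead N (conjW₂ K (diagK g) (diagK g′) (diagK h)) = conjW₂ (mmRead N K) (diagK ĝ) (diagK ĝ′) (diagK ĥ)`. -/
theorem mmRead_conjW₂_diag (K : MKer (d + 1) (Fib d)) :
    mmRead N (conjW₂ K (diagK g) (diagK g') (diagK h)) = conjW₂ (mmRead N K) (diagK (mmSym N g)) (diagK (mmSym N g')) (diagK (mmSym N h)) := by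
  unfold ChartConjugation.conjW₂
  rw [mmRead_add, mmRead_sub, mmRead_add, mmRead_add, mmRead_sub, mmRead_diagK_diagK_comp_left, mmRead_diagK_diagK_comp_left,
    mmRead_diagK_comp_comp_diagK, mmRead_diagK_comp_comp_diagK, mmRead_comp_diagK_right, mmRead_diagK_comp_left]

/-- [folklore] **THE WHOLE SECOND-ORDER CONTACT WITH DIAGONAL GENERATORS PASSES THROUGH THE `mm`-READ**:
`mmRead N (conjW K V V′ (diagK g) (diagK g′) (diagK h)) = conjW (mmRead N K) (mmRead N V) (mmRead N V′) (diagK ĝ) (diagK ĝ′) (diagK ĥ)`. -/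
theorem mmRead_conjW_diag (K V Vp : MKer (d + 1) (Fib d)) :
    mmRead N (conjW K V Vp (diagK g) (diagK g') (diagK h)) =
      conjW (mmRead N K) (mmRead N V) (mmRead N Vp) (diagK (mmSym N g)) (diagK (mmSym N g')) (diagK (mmSym N h)) := by
  unfold ChartConjugation.conjW
  rw [mmRead_add, mmRead_conjW₁_diag, mmRead_conjW₂_diag]

end Outer

/-! ## §2 Against `mm`-reads the contact sees only the field legs of the symbols -/

section Congr

variable (N : ℕ) {g g₁ g' g₁' h h₁ : (Fin (d + 1) → ℤ) → Fib d → ℝ}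

/-- [folklore] `conjW₁` against two `mm`-reads depends only on the field legs of the two generator symbols. -/
theorem conjW₁_mmRead_diag_congr (V Vp : MKer (d + 1) (Fib d)) (hg : ∀ x α, g x (Sum.inl α) = g₁ x (Sum.inl α))
    (hg' : ∀ x α, g' x (Sum.inl α) = g₁' x (Sum.inl α)) :
    conjW₁ (mmRead N V) (mmRead N Vp) (diagK g) (diagK g') = conjW₁ (mmRead N V) (mmRead N Vp) (diagK g₁) (diagK g₁') := by
  funext x z a b
  rw [conjW₁_diag_apply, conjW₁_diag_apply]
  rcases a with α | μ <;> rcases b with β | ν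
  · rw [hg, hg, hg', hg']
  · simp only [mmRead_inr_right, zero_mul]
  · simp only [mmRead_inr_left, zero_mul]
  · simp only [mmRead_inr_left, zero_mul]

/-- [folklore] `conjW₂` against an `mm`-read depends only on the field legs of the three symbols. -/
theorem conjW₂_mmRead_diag_congr (K : MKer (d + 1) (Fib d)) (hg : ∀ x α, g x (Sum.inl α) = g₁ x (Sum.inl α))
    (hg' : ∀ x α, g' x (Sum.inl α) = g₁' x (Sum.inl α)) (hh : ∀ x α, h x (Sum.inl α) = h₁ x (Sum.inl α)) :
    conjW₂ (mmRead N K) (diagK g) (diagK g') (diagK h) = conjW₂ (mmRead N K) (diagK g₁) (diagK g₁') (diagK h₁) := by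
  funext x z a b
  rw [conjW₂_diag_apply, conjW₂_diag_apply]
  rcases a with α | μ <;> rcases b with β | ν
  · rw [hg, hg, hg', hg', hh, hh]
  · simp only [mmRead_inr_right, zero_mul]
  · simp only [mmRead_inr_left, zero_mul]
  · simp only [mmRead_inr_left, zero_mul]

/-- [folklore] **AGAINST `mm`-READS THE SECOND-ORDER CONTACT SEES ONLY THE FIELD LEGS OF ITS GENERATOR SYMBOLS.** -/
theorem conjW_mmRead_diag_congr (K V Vp : MKer (d + 1) (Fib d)) (hg : ∀ x α, g x (Sum.inl α) = g₁ x (Sum.inl α))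
    (hg' : ∀ x α, g' x (Sum.inl α) = g₁' x (Sum.inl α)) (hh : ∀ x α, h x (Sum.inl α) = h₁ x (Sum.inl α)) :
    conjW (mmRead N K) (mmRead N V) (mmRead N Vp) (diagK g) (diagK g') (diagK h) =
      conjW (mmRead N K) (mmRead N V) (mmRead N Vp) (diagK g₁) (diagK g₁') (diagK h₁) := by
  unfold ChartConjugation.conjW
  rw [conjW₁_mmRead_diag_congr N V Vp hg hg', conjW₂_mmRead_diag_congr N K hg hg' hh]

/-- [folklore] **THE COARSE SYMBOL OF THE `ℋ`-DRESSED GENERATOR IS THE NEXT LEVEL'S GENERATOR ON THE FIELD LEGS** (an3's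
`E3CoDressedContact.dressedGenK_zsmul_inr` for a relative inverse `K` of a `σ`-bordered `𝕄` with the rule `E∘𝕄∘K = E` at the centred root):
`mmSym Lc (G^γ_{μ,y}) x′ (inl m) = (γ/(σ·Lc^{d+1})) · ctGen d α Lc μ y x′ (inl m)`, `G^γ_{μ,y} p c := Σ_κ Σ'_u colH K Lc μ y κ u · (γ · ctGen d α Lc κ u p c)`. -/
theorem mmSym_dressedGen_inl {Lc : ℕ} [NeZero Lc] (hLc : 1 ≤ Lc) {K 𝕄 : MKer (d + 1) (Fib d)} (hKs : Spr K) (σ : ℝ) (hσ : σ ≠ 0)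
    (h𝕄mf : ∀ (x y : Fin (d + 1) → ℤ) (κ l : Fin (d + 1)),
      𝕄 x y (Sum.inr κ) (Sum.inl l) = σ * bhKAt d (ctr (d + 1) Lc) Lc x y (Sum.inr κ) (Sum.inl l))
    (h𝕄mm : ∀ (x y : Fin (d + 1) → ℤ) (κ l : Fin (d + 1)), 𝕄 x y (Sum.inr κ) (Sum.inr l) = 0)
    (hEMA : comp (comp (axEc (ctr (d + 1) Lc) Lc) 𝕄) K = axEc (ctr (d + 1) Lc) Lc) (γ : ℝ) (α μ : Fin (d + 1)) (y x' : Fin (d + 1) → ℤ)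
    (m : Fin (d + 1)) :
    mmSym Lc (fun p c => ∑ κ, ∑' u, colH K Lc μ y κ u * (γ * ctGen d α Lc κ u p c)) x' (Sum.inl m) =
      γ / (σ * (Lc : ℝ) ^ (d + 1)) * ctGen d α Lc μ y x' (Sum.inl m) := by
  rw [mmSym_inl]
  have h := dressedGenK_zsmul_inr (d := d) hLc hKs σ hσ h𝕄mf h𝕄mm hEMA α μ y x' m
  have e : (fun κ => ∑' u, colH K Lc μ y κ u * (γ * ctGen d α Lc κ u ((Lc : ℤ) • x') (Sum.inr m))) =
      fun κ => γ * ∑' u, colH K Lc μ y κ u * ctGen d α Lc κ u ((Lc : ℤ) • x') (Sum.inr m) := by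
    funext κ
    rw [← tsum_mul_left]
    exact tsum_congr fun u => by ring
  rw [show (∑ κ, ∑' u, colH K Lc μ y κ u * (γ * ctGen d α Lc κ u ((Lc : ℤ) • x') (Sum.inr m))) =
      γ * ∑ κ, ∑' u, colH K Lc μ y κ u * ctGen d α Lc κ u ((Lc : ℤ) • x') (Sum.inr m) by rw [e, Finset.mul_sum], h]
  ring

end Congr

/-! ## §3 The assembled `mm`-read of `K3OfK(♯) − K3OfK` -/

section Assembled

variable {N : ℕ}

/-- [folklore] **THE `mm`-READ OF THE DERIVATIVE OF THE INVERSE IS THE GENERIC THIRD JET** once the Lagrangian-chart derivative folds into a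
field vertex: `dM K N S M b = vertexOfK K N S̃ b ⟹ mmRead N (K2OfK K N S M b) = e3OfK N K S̃ b`. -/
theorem mmRead_K2OfK_eq_e3OfK (K : MKer (d + 1) (Fib d)) {S M S' : Fin (d + 1) → (Fin (d + 1) → ℤ) → MKer (d + 1) (Fib d)}
    (μ : Fin (d + 1)) (y : Fin (d + 1) → ℤ) (hfold : dM K N S M μ y = vertexOfK K N S' μ y) :
    mmRead N (K2OfK K N S M μ y) = e3OfK N K S' μ y := by
  rw [K2OfK_eq, hfold, mmRead_neg]
  funext x z a b
  rw [e3OfK_apply, Pi.neg_apply, Pi.neg_apply, Pi.neg_apply, Pi.neg_apply]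

/-- [folklore] **THE ASSEMBLED `mm`-READ OF `K3OfK` OF THE ♯-TABLES** (part 1's `K3OfK_sharp_split` read through `mmRead N`): the
level-`(j+1)` field–field second-order table of the ♯-tables is the plain one PLUS A CONTACT OF SIMILARITY SHAPE against `mmRead N K` with
first-order letters `mmRead N (K2OfK … b)`, `mmRead N (K2OfK … c)`, COARSE generators `mmSym N (G b)`, `mmSym N (G c)`, `mmSym N (h b c)`, MINUS
the transported remainder `mmRead N (K ∘ R b c ∘ K)`.  Hypotheses: those of `K3OfK_sharp_split`. -/
theorem mmRead_K3OfK_sharp_split {K 𝕄 E : MKer (d + 1) (Fib d)} (hKs : Spr K) (h𝕄 : Spr 𝕄) (hE : Spr E) (hR : RelInv K 𝕄 E)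
    {S M : Fin (d + 1) → (Fin (d + 1) → ℤ) → MKer (d + 1) (Fib d)}
    {g : Fin (d + 1) → (Fin (d + 1) → ℤ) → (Fin (d + 1) → ℤ) → Fib d → ℝ}
    {W R : Fin (d + 1) → (Fin (d + 1) → ℤ) → Fin (d + 1) → (Fin (d + 1) → ℤ) → MKer (d + 1) (Fib d)}
    {h : Fin (d + 1) → (Fin (d + 1) → ℤ) → Fin (d + 1) → (Fin (d + 1) → ℤ) → (Fin (d + 1) → ℤ) → Fib d → ℝ}
    (μ : Fin (d + 1)) (y : Fin (d + 1) → ℤ) (ν : Fin (d + 1)) (y' : Fin (d + 1) → ℤ)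
    (hS : ∀ (μ : Fin (d + 1)) (y : Fin (d + 1) → ℤ) (κ : Fin (d + 1)) (x z : Fin (d + 1) → ℤ) (a b : Fib d),
      Summable fun u => colH K N μ y κ u * S κ u x z a b)
    (hg : ∀ (μ : Fin (d + 1)) (y : Fin (d + 1) → ℤ) (κ : Fin (d + 1)) (p : Fin (d + 1) → ℤ) (c : Fib d),
      Summable fun u => colH K N μ y κ u * g κ u p c)
    (hDb : Loc (dM K N S M μ y)) (hDc : Loc (dM K N S M ν y')) (hW : Loc (W μ y ν y')) (hRm : Loc (R μ y ν y'))
    (hGb : Loc (diagK fun p c => ∑ κ, ∑' u, colH K N μ y κ u * g κ u p c))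
    (hGc : Loc (diagK fun p c => ∑ κ, ∑' u, colH K N ν y' κ u * g κ u p c)) (hX₂ : Loc (diagK (h μ y ν y')))
    (hEGb : comp E (diagK fun p c => ∑ κ, ∑' u, colH K N μ y κ u * g κ u p c) = comp (diagK fun p c => ∑ κ, ∑' u, colH K N μ y κ u * g κ u p c) E)
    (hEGc : comp E (diagK fun p c => ∑ κ, ∑' u, colH K N ν y' κ u * g κ u p c) = comp (diagK fun p c => ∑ κ, ∑' u, colH K N ν y' κ u * g κ u p c) E)
    (hEX₂ : comp E (diagK (h μ y ν y')) = comp (diagK (h μ y ν y')) E) :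
    mmRead N (K3OfK K N (fun κ u => S κ u + conjV 𝕄 (diagK (g κ u))) M
        (fun μ y ν y' => W μ y ν y' +
          conjW 𝕄 (dM K N S M μ y) (dM K N S M ν y') (diagK fun p c => ∑ κ, ∑' u, colH K N μ y κ u * g κ u p c)
            (diagK fun p c => ∑ κ, ∑' u, colH K N ν y' κ u * g κ u p c) (diagK (h μ y ν y')) + R μ y ν y') μ y ν y') =
      mmRead N (K3OfK K N S M W μ y ν y') +
        conjW (mmRead N K) (mmRead N (K2OfK K N S M μ y)) (mmRead N (K2OfK K N S M ν y'))
          (diagK (mmSym N fun p c => ∑ κ, ∑' u, colH K N μ y κ u * g κ u p c))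
          (diagK (mmSym N fun p c => ∑ κ, ∑' u, colH K N ν y' κ u * g κ u p c)) (diagK (mmSym N (h μ y ν y'))) -
        mmRead N (comp (comp K (R μ y ν y')) K) := by
  rw [SecondOrderInverseShape.K3OfK_sharp_split hKs h𝕄 hE hR (X₂ := fun μ y ν y' => diagK (h μ y ν y')) μ y ν y' hS hg hDb hDc hW hRm
    hGb hGc hX₂ hEGb hEGc hEX₂, mmRead_sub, mmRead_add, mmRead_conjW_diag]

end Assembled

end

end Summit.QuantumFields.BalabanUV.Beta.SecondOrderContactMmRead
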